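import Literature.NumberTheory.Automorphic.GL2CESHModel
import HarnessLib

/-!
# A finite-dimensional `𝔰𝔩₂ × 𝔰𝔩₂`-module with Casimirs `½ d(d+2)` contains the coordinate model
# `Sym^d ⊗ \overline{Sym}^d`: the bi-extremal vector and the intertwiner

Generic representation theory for the six lawful operators `L(E), L(F), L(H), R(E), R(F), R(H)`
(`GL2CKType.Ops`) on a finite-dimensional complex space `E` with `Ω_L = Ω_R = ½ d(d+2)`:

* `lOps`, `rOpsT` — the auxiliary operator families `(L(E), L(F), L(H); 0)` and
  `(R(F), R(E), −R(H); 0)` (the `R`-triple transposed), lawful, so that the `𝔨`-highest-weight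
  theory of `GL2CUnitaryKTypes` / `GL2CESHModel` applies to each factor separately;
* `exists_biExtremal` — **a non-zero `u₀ ∈ E` with `L(E) u₀ = 0`, `L(H) u₀ = d u₀`, `R(F) u₀ = 0`,
  `R(H) u₀ = −d u₀`** (an `L`-highest and `R`-lowest weight vector; the weights are pinned by the
  Casimirs);
* `bVec l m = L(F)^{d−l} R(E)^m u₀` and the action of the six operators on them (`LF_bVec`, …);
* `theta : GL2CESH.model ℂ d →ₗ[ℂ] E`, `θ(δ_{l,m}) = l! (d−m)! · bVec l m` (`theta_single`), which
  **intertwines the coordinate operators `GL2CESH.coeff d` with the six operators**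
  (`theta_coeff_LE`, …, collected in `theta_intertwines`) and is **injective** (`theta_injective`:
  the `bVec l m` are joint weight vectors with distinct weights); with `dim E = (d+1)²` it is a
  linear isomorphism (`thetaEquiv`).
[cite: FultonHarrisGTM129, §11.1] [cite: Knapp2002, §V.4]

Definitions with bodies and theorems; no named fact.
-/

noncomputable section

open scoped ComplexConjugate BigOperators
open Complex Finset Module

namespace Literature.NumberTheory.Automorphic

namespace GL2CKType

namespace Ops

open Sl2Coord GL2CESH

variable {E : Type*} [AddCommGroup E] [Module ℂ E] (O : Ops E)

/-! ### The auxiliary one-sided operator families -/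

/-- The family `(L(E), L(F), L(H); 0, 0, 0)`: its `𝔨`-triple is the `L`-triple. [folklore] -/
def lOps : Ops E := ⟨O.LE, O.LF, O.LH, 0, 0, 0⟩

/-- The family `(R(F), R(E), −R(H); 0, 0, 0)`: its `𝔨`-triple is the transposed `R`-triple, whose
highest-weight vectors are the `R`-LOWEST-weight vectors. [folklore] -/
def rOpsT : Ops E := ⟨O.RF, O.RE, -O.RH, 0, 0, 0⟩

/-- Unfolding. [folklore] -/
theorem lOps_Ek (v : E) : O.lOps.Ek v = O.LE v := by simp [lOps, Ek_apply]
/-- Unfolding. [folklore] -/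
theorem lOps_Fk (v : E) : O.lOps.Fk v = O.LF v := by simp [lOps, Fk_apply]
/-- Unfolding. [folklore] -/
theorem lOps_Hk (v : E) : O.lOps.Hk v = O.LH v := by simp [lOps, Hk_apply]
/-- Unfolding. [folklore] -/
theorem rOpsT_Ek (v : E) : O.rOpsT.Ek v = O.RF v := by simp [rOpsT, Ek_apply]
/-- Unfolding. [folklore] -/
theorem rOpsT_Fk (v : E) : O.rOpsT.Fk v = O.RE v := by simp [rOpsT, Fk_apply]
/-- Unfolding. [folklore] -/
theorem rOpsT_Hk (v : E) : O.rOpsT.Hk v = -O.RH v := by simp [rOpsT, Hk_apply]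

variable {O}

/-- `lOps` is lawful. [folklore] -/
theorem isLawful_lOps (hO : O.IsLawful) : O.lOps.IsLawful where
  lhe := hO.lhe
  lhf := hO.lhf
  lef := hO.lef
  rhe v := by simp [lOps]
  rhf v := by simp [lOps]
  ref v := by simp [lOps]
  cEE v := by simp [lOps]
  cEF v := by simp [lOps]
  cEH v := by simp [lOps]
  cFE v := by simp [lOps]
  cFF v := by simp [lOps]
  cFH v := by simp [lOps]
  cHE v := by simp [lOps]
  cHF v := by simp [lOps]
  cHH v := by simp [lOps]

/-- `rOpsT` is lawful (`(F, E, −H)` is again an `𝔰𝔩₂`-triple). [folklore] -/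
theorem isLawful_rOpsT (hO : O.IsLawful) : O.rOpsT.IsLawful where
  lhe v := by
    simp only [rOpsT, LinearMap.neg_apply, map_neg, hO.rhf]
    module
  lhf v := by
    simp only [rOpsT, LinearMap.neg_apply, map_neg, hO.rhe]
    module
  lef v := by
    simp only [rOpsT, LinearMap.neg_apply]
    have := hO.ref v
    rw [this]; abel
  rhe v := by simp [rOpsT]
  rhf v := by simp [rOpsT]
  ref v := by simp [rOpsT]
  cEE v := by simp [rOpsT]
  cEF v := by simp [rOpsT]
  cEH v := by simp [rOpsT]
  cFE v := by simp [rOpsT]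
  cFF v := by simp [rOpsT]
  cFH v := by simp [rOpsT]
  cHE v := by simp [rOpsT]
  cHF v := by simp [rOpsT]
  cHH v := by simp [rOpsT]

/-! ### The bi-extremal vector -/

/-- `n ↦ n(n+2)` is injective on `ℕ` (through `ℂ`). [folklore] -/
theorem nat_eq_of_casimir_eq {n d : ℕ} (h : ((2 : ℂ)⁻¹ * ((n : ℂ) * ((n : ℂ) + 2))) = (2 : ℂ)⁻¹ * ((d : ℂ) * ((d : ℂ) + 2))) :
    n = d := by
  have h1 : ((n * (n + 2) : ℕ) : ℂ) = ((d * (d + 2) : ℕ) : ℂ) := by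
    push_cast
    have := mul_left_cancel₀ (inv_ne_zero (two_ne_zero' ℂ)) h
    exact this
  have h2 : n * (n + 2) = d * (d + 2) := by exact_mod_cast h1
  have h3 : (n + 1) ^ 2 = (d + 1) ^ 2 := by nlinarith
  have := Nat.pow_left_injective (by norm_num : (2 : ℕ) ≠ 0) h3
  omega

/-- **The Casimir pins the weight of an `L`-highest-weight vector**: if `L(E) u = 0`,
`L(H) u = n u` (`n ∈ ℕ`), `u ≠ 0` and `Ω_L = ½ d(d+2)` then `n = d`. [cite: Knapp2002, §V.4] -/
theorem weight_eq_of_casL (hO : O.IsLawful) {d : ℕ} (hcL : ∀ v, O.casL v = ((2 : ℂ)⁻¹ * ((d : ℂ) * ((d : ℂ) + 2))) • v)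
    {u : E} (hu : u ≠ 0) {n : ℕ} (hE : O.LE u = 0) (hH : O.LH u = (n : ℂ) • u) : n = d := by
  have h1 : O.casL u = ((2 : ℂ)⁻¹ * ((n : ℂ) * ((n : ℂ) + 2))) • u := by
    have hlef := hO.lef u
    rw [hE, map_zero, zero_add] at hlef
    rw [casL_apply, hlef, hE, map_zero, add_zero, hH, map_smul, hH]
    simp only [smul_smul]
    rw [← add_smul]
    congr 1; ring
  rw [hcL] at h1
  exact (nat_eq_of_casimir_eq (smul_left_injective ℂ hu h1).symm)

/-- The same for the `R`-lowest-weight vectors: `R(F) u = 0`, `R(H) u = −n u`, `Ω_R = ½ d(d+2)`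
force `n = d`. [cite: Knapp2002, §V.4] -/
theorem weight_eq_of_casR (hO : O.IsLawful) {d : ℕ} (hcR : ∀ v, O.casR v = ((2 : ℂ)⁻¹ * ((d : ℂ) * ((d : ℂ) + 2))) • v)
    {u : E} (hu : u ≠ 0) {n : ℕ} (hF : O.RF u = 0) (hH : O.RH u = -((n : ℂ) • u)) : n = d := by
  have hFE : O.RF (O.RE u) = (n : ℂ) • u := by
    have := hO.ref u
    rw [hF, map_zero] at this
    -- `RE (RF u) = 0 = RF (RE u) + RH u`
    have h2 : O.RF (O.RE u) = -O.RH u := eq_neg_of_add_eq_zero_left this.symm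
    rw [h2, hH, neg_neg]
  have h1 : O.casR u = ((2 : ℂ)⁻¹ * ((n : ℂ) * ((n : ℂ) + 2))) • u := by
    rw [casR_apply, hF, map_zero, add_zero, hFE, hH, map_neg, map_smul, hH]
    simp only [smul_neg, neg_neg, smul_smul]
    rw [← add_smul]
    congr 1; ring
  rw [hcR] at h1
  exact (nat_eq_of_casimir_eq (smul_left_injective ℂ hu h1).symm)

section BiExtremal

variable [FiniteDimensional ℂ E]

/-- The whole space as the finite-dimensional stable subspace required by the `𝔨`-theory. [folklore] -/
theorem hfin_top (O' : Ops E) (v : E) : ∃ S : Submodule ℂ E, v ∈ S ∧ FiniteDimensional ℂ S ∧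
    (∀ x ∈ S, O'.Ek x ∈ S) ∧ (∀ x ∈ S, O'.Fk x ∈ S) ∧ (∀ x ∈ S, O'.Hk x ∈ S) :=
  ⟨⊤, Submodule.mem_top, inferInstance, fun _ _ => Submodule.mem_top, fun _ _ => Submodule.mem_top,
    fun _ _ => Submodule.mem_top⟩

/-- **The bi-extremal vector.**  A non-zero finite-dimensional module for six lawful operators with
`Ω_L = Ω_R = ½ d(d+2)` contains `u₀ ≠ 0` with `L(E) u₀ = 0`, `L(H) u₀ = d u₀`, `R(F) u₀ = 0`,
`R(H) u₀ = −d u₀`. [cite: FultonHarrisGTM129, §11.1] [cite: Knapp2002, §V.4] -/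
theorem exists_biExtremal (hO : O.IsLawful) {d : ℕ}
    (hcL : ∀ v, O.casL v = ((2 : ℂ)⁻¹ * ((d : ℂ) * ((d : ℂ) + 2))) • v)
    (hcR : ∀ v, O.casR v = ((2 : ℂ)⁻¹ * ((d : ℂ) * ((d : ℂ) + 2))) • v) {v : E} (hv : v ≠ 0) :
    ∃ u₀ : E, u₀ ≠ 0 ∧ O.LE u₀ = 0 ∧ O.LH u₀ = (d : ℂ) • u₀ ∧ O.RF u₀ = 0 ∧ O.RH u₀ = -((d : ℂ) • u₀) := by
  -- (1) an `L`-highest-weight vector, of weight `d`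
  obtain ⟨u₁, n₁, hu₁0, hu₁, -⟩ := exists_isHW_nat (isLawful_lOps hO) (hfin_top O.lOps) hv
  have hE₁ : O.LE u₁ = 0 := by rw [← lOps_Ek]; exact hu₁.ek
  have hH₁ : O.LH u₁ = (n₁ : ℂ) • u₁ := by rw [← lOps_Hk]; exact hu₁.hk
  have hn₁ : n₁ = d := weight_eq_of_casL hO hcL hu₁0 hE₁ hH₁
  subst hn₁
  -- (2) the `R`-stable subspace of such vectors
  let S : Submodule ℂ E :=
    { carrier := {u | O.LE u = 0 ∧ O.LH u = (n₁ : ℂ) • u}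
      zero_mem' := by simp
      add_mem' := by
        rintro a b ⟨ha1, ha2⟩ ⟨hb1, hb2⟩
        exact ⟨by rw [map_add, ha1, hb1, add_zero], by rw [map_add, ha2, hb2, smul_add]⟩
      smul_mem' := by
        rintro c a ⟨ha1, ha2⟩
        exact ⟨by rw [map_smul, ha1, smul_zero], by rw [map_smul, ha2, smul_comm]⟩ }
  have hS : ∀ u, u ∈ S ↔ O.LE u = 0 ∧ O.LH u = (n₁ : ℂ) • u := fun u => Iff.rfl
  have hpres : O.rOpsT.Preserves S := by
    refine ⟨?_, ?_, ?_, ?_, ?_, ?_⟩ <;> intro x hx <;> rw [hS] at hx ⊢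
    · exact ⟨by rw [show O.rOpsT.LE = O.RF from rfl, ← hO.cFE, hx.1, map_zero],
        by rw [show O.rOpsT.LE = O.RF from rfl, ← hO.cFH, hx.2, map_smul]⟩
    · exact ⟨by rw [show O.rOpsT.LF = O.RE from rfl, ← hO.cEE, hx.1, map_zero],
        by rw [show O.rOpsT.LF = O.RE from rfl, ← hO.cEH, hx.2, map_smul]⟩
    · refine ⟨?_, ?_⟩
      · rw [show O.rOpsT.LH = -O.RH from rfl, LinearMap.neg_apply, map_neg, ← hO.cHE, hx.1, map_zero, neg_zero]
      · rw [show O.rOpsT.LH = -O.RH from rfl, LinearMap.neg_apply, map_neg, ← hO.cHH, hx.2, map_smul, smul_neg]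
    · simp [rOpsT]
    · simp [rOpsT]
    · simp [rOpsT]
  -- (3) an `R`-lowest-weight vector inside `S`
  have hu₁S : u₁ ∈ S := (hS u₁).2 ⟨hE₁, hH₁⟩
  have hv₁ : (⟨u₁, hu₁S⟩ : S) ≠ 0 := fun h => hu₁0 (congrArg Subtype.val h)
  haveI : FiniteDimensional ℂ S := FiniteDimensional.finiteDimensional_submodule S
  obtain ⟨u₀, n₀, hu₀0, hu₀, -⟩ := exists_isHW_nat ((isLawful_rOpsT hO).restrict hpres)
    (hfin_top (O.rOpsT.restrict hpres)) hv₁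
  have hF₀ : O.RF (u₀ : E) = 0 := by
    have := congrArg Subtype.val hu₀.ek
    rw [restrict_Ek] at this
    rwa [rOpsT_Ek] at this
  have hH₀ : O.RH (u₀ : E) = -((n₀ : ℂ) • (u₀ : E)) := by
    have := congrArg Subtype.val hu₀.hk
    rw [restrict_Hk, Submodule.coe_smul] at this
    rw [rOpsT_Hk] at this
    rw [← this, neg_neg]
  have hu₀0' : (u₀ : E) ≠ 0 := fun h => hu₀0 (Subtype.ext h)
  have hn₀ : n₀ = n₁ := weight_eq_of_casR hO hcR hu₀0' hF₀ hH₀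
  subst hn₀
  obtain ⟨hE₀, hLH₀⟩ := (hS u₀).1 u₀.2
  exact ⟨u₀, hu₀0', hE₀, hLH₀, hF₀, hH₀⟩

end BiExtremal

/-! ### The strings `b_{l,m} = L(F)^{d−l} R(E)^m u₀` -/

/-- Commuting operators commute with powers. [folklore] -/
theorem apply_pow_of_comm {A B : Module.End ℂ E} (h : ∀ v, A (B v) = B (A v)) (m : ℕ) (v : E) :
    A ((B ^ m) v) = (B ^ m) (A v) := by
  induction m with
  | zero => simp
  | succ m ih => rw [pow_succ', Module.End.mul_apply, h, ih, Module.End.mul_apply]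

section Strings

variable (d : ℕ) (u₀ : E)

/-- **`b_{l,m} = L(F)^{d−l} R(E)^m u₀`.** [cite: FultonHarrisGTM129, §11.1] -/
def bVec (l m : ℕ) : E := (O.LF ^ (d - l)) ((O.RE ^ m) u₀)

variable {d u₀} (hO : O.IsLawful) (hLE : O.LE u₀ = 0) (hLH : O.LH u₀ = (d : ℂ) • u₀) (hRF : O.RF u₀ = 0)
  (hRH : O.RH u₀ = -((d : ℂ) • u₀))
include hO

/-- `R(E)^m u₀` is again `L`-highest of weight `d`. [folklore] -/
theorem isHW_RE_pow (hLE : O.LE u₀ = 0) (hLH : O.LH u₀ = (d : ℂ) • u₀) (m : ℕ) :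
    O.lOps.IsHW ((O.RE ^ m) u₀) ((d : ℕ) : ℂ) := by
  refine ⟨?_, ?_⟩
  · rw [lOps_Ek, apply_pow_of_comm (fun v => (hO.cEE v).symm), hLE, map_zero]
  · rw [lOps_Hk, apply_pow_of_comm (fun v => (hO.cEH v).symm), hLH, map_smul]

omit hO in
/-- `u₀` is `rOpsT`-highest of weight `d` when `R(F) u₀ = 0`, `R(H) u₀ = −d u₀`. [folklore] -/
theorem isHW_rOpsT (hRF : O.RF u₀ = 0) (hRH : O.RH u₀ = -((d : ℂ) • u₀)) :
    O.rOpsT.IsHW u₀ ((d : ℕ) : ℂ) :=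
  ⟨by rw [rOpsT_Ek, hRF], by rw [rOpsT_Hk, hRH, neg_neg]⟩

include hLE hLH in
/-- **`L(H) b_{l,m} = (2l − d) b_{l,m}`** (`l ≤ d`). [cite: FultonHarrisGTM129, §11.1] -/
theorem LH_bVec {l : ℕ} (hl : l ≤ d) (m : ℕ) :
    O.LH (O.bVec d u₀ l m) = (((2 * l : ℕ) : ℂ) - d) • O.bVec d u₀ l m := by
  have h := Hk_Fk_pow (isLawful_lOps hO) (isHW_RE_pow hO hLE hLH m).hk (d - l)
  rw [lOps_Hk] at h
  have hF : O.lOps.Fk = O.LF := LinearMap.ext (lOps_Fk O)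
  rw [hF] at h
  rw [bVec, h]
  congr 1
  push_cast [Nat.cast_sub hl]
  ring

omit hO in
/-- **`L(F) b_{l+1,m} = b_{l,m}`** (`l + 1 ≤ d`). [cite: FultonHarrisGTM129, §11.1] -/
theorem LF_bVec_succ {l : ℕ} (hl : l + 1 ≤ d) (m : ℕ) :
    O.LF (O.bVec d u₀ (l + 1) m) = O.bVec d u₀ l m := by
  rw [bVec, bVec, ← Module.End.mul_apply, ← pow_succ', show d - (l + 1) + 1 = d - l by omega]

include hLE hLH in
/-- **`L(F) b_{0,m} = 0`** in a finite-dimensional `E` (`L(F)^{d+1}` kills a weight-`d` string).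
[cite: FultonHarrisGTM129, §11.1] -/
theorem LF_bVec_zero [FiniteDimensional ℂ E] (m : ℕ) : O.LF (O.bVec d u₀ 0 m) = 0 := by
  have h := Fk_pow_succ_eq_zero (O := O.lOps) (S := ⊤) (isLawful_lOps hO) (fun _ _ => Submodule.mem_top)
    (fun _ _ => Submodule.mem_top) (fun _ _ => Submodule.mem_top) Submodule.mem_top (isHW_RE_pow hO hLE hLH m)
  have hF : O.lOps.Fk = O.LF := LinearMap.ext (lOps_Fk O)
  rw [hF, pow_succ', Module.End.mul_apply] at h
  rw [bVec, Nat.sub_zero]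
  exact h

include hLE hLH in
/-- **`L(E) b_{l,m} = (d − l)(l + 1) b_{l+1,m}`** (`l < d`). [cite: FultonHarrisGTM129, §11.1] -/
theorem LE_bVec {l : ℕ} (hl : l < d) (m : ℕ) :
    O.LE (O.bVec d u₀ l m) = (((d - l : ℕ) : ℂ) * ((l : ℂ) + 1)) • O.bVec d u₀ (l + 1) m := by
  have h := Ek_Fk_pow_succ (isLawful_lOps hO) (isHW_RE_pow hO hLE hLH m) (d - l - 1)
  rw [lOps_Ek] at h
  have hF : O.lOps.Fk = O.LF := LinearMap.ext (lOps_Fk O)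
  rw [hF, show d - l - 1 + 1 = d - l by omega] at h
  rw [bVec, bVec, h, show d - (l + 1) = d - l - 1 by omega]
  congr 1
  have : ((d - l - 1 : ℕ) : ℂ) = (d : ℂ) - l - 1 := by push_cast [Nat.cast_sub (show 1 ≤ d - l by omega), Nat.cast_sub hl.le]; ring
  rw [this]; push_cast [Nat.cast_sub hl.le]; ring

include hLE in
/-- **`L(E) b_{d,m} = 0`.** [cite: FultonHarrisGTM129, §11.1] -/
theorem LE_bVec_top (m : ℕ) : O.LE (O.bVec d u₀ d m) = 0 := by
  rw [bVec, Nat.sub_self, pow_zero, Module.End.one_apply, apply_pow_of_comm (fun v => (hO.cEE v).symm), hLE,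
    map_zero]

include hRF hRH in
/-- **`R(H) b_{l,m} = (2m − d) b_{l,m}`.** [cite: FultonHarrisGTM129, §11.1] -/
theorem RH_bVec (l m : ℕ) :
    O.RH (O.bVec d u₀ l m) = (((2 * m : ℕ) : ℂ) - d) • O.bVec d u₀ l m := by
  have h := Hk_Fk_pow (isLawful_rOpsT hO) (isHW_rOpsT hRF hRH).hk m
  rw [rOpsT_Hk] at h
  have hF : O.rOpsT.Fk = O.RE := LinearMap.ext (rOpsT_Fk O)
  rw [hF] at h
  rw [bVec, apply_pow_of_comm hO.cHF, show O.RH ((O.RE ^ m) u₀) = -(((d : ℂ) - 2 * m) • (O.RE ^ m) u₀) by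
    rw [← h, neg_neg], map_neg, map_smul, ← neg_smul]
  congr 1
  push_cast
  ring

/-- **`R(E) b_{l,m} = b_{l,m+1}`.** [cite: FultonHarrisGTM129, §11.1] -/
theorem RE_bVec (l m : ℕ) : O.RE (O.bVec d u₀ l m) = O.bVec d u₀ l (m + 1) := by
  rw [bVec, bVec, apply_pow_of_comm hO.cEF, pow_succ' O.RE m, Module.End.mul_apply]

include hRF hRH in
/-- **`b_{l,d+1} = 0`** in a finite-dimensional `E`. [cite: FultonHarrisGTM129, §11.1] -/
theorem bVec_top_succ [FiniteDimensional ℂ E] (l : ℕ) : O.bVec d u₀ l (d + 1) = 0 := by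
  have h := Fk_pow_succ_eq_zero (O := O.rOpsT) (S := ⊤) (isLawful_rOpsT hO) (fun _ _ => Submodule.mem_top)
    (fun _ _ => Submodule.mem_top) (fun _ _ => Submodule.mem_top) Submodule.mem_top (isHW_rOpsT hRF hRH)
  have hF : O.rOpsT.Fk = O.RE := LinearMap.ext (rOpsT_Fk O)
  rw [hF] at h
  rw [bVec, h, map_zero]

include hRF hRH in
/-- **`R(F) b_{l,m+1} = (m+1)(d − m) b_{l,m}`.** [cite: FultonHarrisGTM129, §11.1] -/
theorem RF_bVec_succ (l m : ℕ) :
    O.RF (O.bVec d u₀ l (m + 1)) = (((m : ℂ) + 1) * ((d : ℂ) - m)) • O.bVec d u₀ l m := by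
  have h := Ek_Fk_pow_succ (isLawful_rOpsT hO) (isHW_rOpsT hRF hRH) m
  rw [rOpsT_Ek] at h
  have hF : O.rOpsT.Fk = O.RE := LinearMap.ext (rOpsT_Fk O)
  rw [hF] at h
  rw [bVec, bVec, apply_pow_of_comm hO.cFF, h, map_smul]

include hRF in
/-- **`R(F) b_{l,0} = 0`.** [cite: FultonHarrisGTM129, §11.1] -/
theorem RF_bVec_zero (l : ℕ) : O.RF (O.bVec d u₀ l 0) = 0 := by
  rw [bVec, pow_zero, Module.End.one_apply, apply_pow_of_comm hO.cFF, hRF, map_zero]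

include hLE hLH hRF hRH in
/-- **`b_{l,m} ≠ 0`** for `l, m ≤ d` (`u₀ ≠ 0`, finite-dimensional `E`). [cite: FultonHarrisGTM129, §11.1] -/
theorem bVec_ne_zero [FiniteDimensional ℂ E] (hu : u₀ ≠ 0) (l : ℕ) {m : ℕ} (hm : m ≤ d) :
    O.bVec d u₀ l m ≠ 0 := by
  -- `R(E)^m u₀ ≠ 0`
  have h1 : (O.RE ^ m) u₀ ≠ 0 := by
    have h := Fk_pow_ne_zero (O := O.rOpsT) (S := ⊤) (isLawful_rOpsT hO) (fun _ _ => Submodule.mem_top)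
      (fun _ _ => Submodule.mem_top) (fun _ _ => Submodule.mem_top) Submodule.mem_top hu (isHW_rOpsT hRF hRH) hm
    have hF : O.rOpsT.Fk = O.RE := LinearMap.ext (rOpsT_Fk O)
    rwa [hF] at h
  -- then `L(F)^{d-l}` of it
  have h := Fk_pow_ne_zero (O := O.lOps) (S := ⊤) (isLawful_lOps hO) (fun _ _ => Submodule.mem_top)
    (fun _ _ => Submodule.mem_top) (fun _ _ => Submodule.mem_top) Submodule.mem_top h1 (isHW_RE_pow hO hLE hLH m)
    (show d - l ≤ d from Nat.sub_le d l)
  have hF : O.lOps.Fk = O.LF := LinearMap.ext (lOps_Fk O)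
  rwa [hF] at h

end Strings

/-! ### The coordinate model: elementary vectors and the action of `coeff d` on them -/

section Model

variable (d : ℕ)

/-- The elementary vector `δ_{l,m}` of the coordinate model (zero if `l > d` or `m > d`). [folklore] -/
def single (l m : ℕ) : GL2CESH.model ℂ d :=
  ⟨fun l' m' => if l' = l ∧ m' = m ∧ l ≤ d ∧ m ≤ d then 1 else 0, fun l' m' h => by
    simp only [ite_eq_right_iff, one_ne_zero, imp_false, not_and, not_le]
    rintro rfl rfl hl
    omega⟩

/-- Unfolding. [folklore] -/
theorem single_apply (l m l' m' : ℕ) :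
    ((single d l m : GL2CESH.model ℂ d) : ℕ → ℕ → ℂ) l' m' = if l' = l ∧ m' = m ∧ l ≤ d ∧ m ≤ d then 1 else 0 := rfl

/-- **Expansion in elementary vectors**: `u = ∑_{l,m ≤ d} u_{l,m} δ_{l,m}`. [folklore] -/
theorem eq_sum_single (u : GL2CESH.model ℂ d) :
    u = ∑ l ∈ range (d + 1), ∑ m ∈ range (d + 1), ((u : ℕ → ℕ → ℂ) l m) • single d l m := by
  apply Subtype.ext
  funext l' m'
  rw [AddSubmonoidClass.coe_finsetSum]
  simp only [AddSubmonoidClass.coe_finsetSum, Finset.sum_apply, Submodule.coe_smul, Pi.smul_apply, single_apply,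
    smul_eq_mul, mul_ite, mul_one, mul_zero]
  by_cases h : l' ≤ d ∧ m' ≤ d
  · rw [Finset.sum_eq_single l', Finset.sum_eq_single m']
    · simp [h.1, h.2]
    · intro m hm hne; simp [Ne.symm hne]
    · intro hl'; exact absurd (Finset.mem_range.2 (by omega)) hl'
    · intro l hl hne
      exact Finset.sum_eq_zero fun m _ => by simp [Ne.symm hne]
    · intro hl'; exact absurd (Finset.mem_range.2 (by omega)) hl'
  · rw [u.2 l' m' (by omega)]
    symm
    refine Finset.sum_eq_zero fun l hl => Finset.sum_eq_zero fun m hm => ?_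
    rw [Finset.mem_range] at hl hm
    split_ifs with h'
    · obtain ⟨rfl, rfl, -, -⟩ := h'; exact absurd ⟨by omega, by omega⟩ h
    · rfl

/-- Two linear maps on the model agreeing on the elementary vectors agree. [folklore] -/
theorem model_hom_ext {N : Type*} [AddCommGroup N] [Module ℂ N] {f g : GL2CESH.model ℂ d →ₗ[ℂ] N}
    (h : ∀ l m, l ≤ d → m ≤ d → f (single d l m) = g (single d l m)) : f = g := by
  refine LinearMap.ext fun u => ?_
  rw [eq_sum_single d u, map_sum, map_sum]
  refine Finset.sum_congr rfl fun l hl => ?_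
  rw [map_sum, map_sum]
  refine Finset.sum_congr rfl fun m hm => ?_
  rw [map_smul, map_smul, h l m (by simpa [Nat.lt_succ_iff] using hl) (by simpa [Nat.lt_succ_iff] using hm)]

/-- `L(F) δ_{l+1,m} = (l+1) δ_{l,m}`. [folklore] -/
theorem coeff_LF_single_succ {l m : ℕ} (hl : l + 1 ≤ d) (hm : m ≤ d) :
    (GL2CESH.coeff (C := ℂ) d).LF (single d (l + 1) m) = ((l + 1 : ℕ) : ℂ) • single d l m := by
  apply Subtype.ext; funext l' m'
  rw [GL2CESH.coeff, restrict_LF, GL2CESH.opsCoeff_LF_apply, Submodule.coe_smul, Pi.smul_apply, Pi.smul_apply,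
    single_apply, single_apply]
  by_cases h : l' = l ∧ m' = m
  · obtain ⟨rfl, rfl⟩ := h; simp [hl, hm, show l' ≤ d by omega]
  · have h' := not_and_or.1 h
    rw [if_neg, if_neg, smul_zero, smul_zero] <;> (rintro ⟨h1, h2, -, -⟩; rcases h' with h' | h' <;> omega)

/-- `L(F) δ_{0,m} = 0`. [folklore] -/
theorem coeff_LF_single_zero (m : ℕ) : (GL2CESH.coeff (C := ℂ) d).LF (single d 0 m) = 0 := by
  apply Subtype.ext; funext l' m'
  rw [GL2CESH.coeff, restrict_LF, GL2CESH.opsCoeff_LF_apply, single_apply]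
  simp

/-- `L(E) δ_{l,m} = (d − l) δ_{l+1,m}` (`l < d`). [folklore] -/
theorem coeff_LE_single {l m : ℕ} (hl : l < d) (hm : m ≤ d) :
    (GL2CESH.coeff (C := ℂ) d).LE (single d l m) = ((d - l : ℕ) : ℂ) • single d (l + 1) m := by
  apply Subtype.ext; funext l' m'
  rw [GL2CESH.coeff, restrict_LE, Submodule.coe_smul, Pi.smul_apply, Pi.smul_apply, single_apply]
  rcases l' with _ | l'
  · rw [GL2CESH.opsCoeff_LE_apply_zero]; simp
  · rw [GL2CESH.opsCoeff_LE_apply_succ, single_apply]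
    by_cases h : l' = l ∧ m' = m
    · obtain ⟨rfl, rfl⟩ := h; simp [hl.le, hm, show l' + 1 ≤ d by omega]
    · have h' := not_and_or.1 h
      rw [if_neg, if_neg, smul_zero, smul_zero] <;> (rintro ⟨h1, h2, -, -⟩; rcases h' with h' | h' <;> omega)

/-- `L(E) δ_{d,m} = 0`. [folklore] -/
theorem coeff_LE_single_top (m : ℕ) : (GL2CESH.coeff (C := ℂ) d).LE (single d d m) = 0 := by
  apply Subtype.ext; funext l' m'
  rw [GL2CESH.coeff, restrict_LE]
  rcases l' with _ | l'
  · rw [GL2CESH.opsCoeff_LE_apply_zero]; rfl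
  · rw [GL2CESH.opsCoeff_LE_apply_succ, single_apply]
    by_cases h : l' = d
    · subst h; simp
    · rw [if_neg (by tauto)]; simp

/-- `L(H) δ_{l,m} = (2l − d) δ_{l,m}`. [folklore] -/
theorem coeff_LH_single (l m : ℕ) :
    (GL2CESH.coeff (C := ℂ) d).LH (single d l m) = (((2 * l : ℕ) : ℂ) - d) • single d l m := by
  apply Subtype.ext; funext l' m'
  rw [GL2CESH.coeff, restrict_LH, GL2CESH.opsCoeff_LH_apply, Submodule.coe_smul, Pi.smul_apply, Pi.smul_apply,
    single_apply]
  by_cases h : l' = l ∧ m' = m ∧ l ≤ d ∧ m ≤ d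
  · obtain ⟨rfl, -, -, -⟩ := h; rfl
  · rw [if_neg h, smul_zero, smul_zero]

/-- `R(E) δ_{l,m} = (d − m) δ_{l,m+1}` (`m < d`). [folklore] -/
theorem coeff_RE_single {l m : ℕ} (hl : l ≤ d) (hm : m < d) :
    (GL2CESH.coeff (C := ℂ) d).RE (single d l m) = ((d - m : ℕ) : ℂ) • single d l (m + 1) := by
  apply Subtype.ext; funext l' m'
  rw [GL2CESH.coeff, restrict_RE, GL2CESH.opsCoeff_RE, Submodule.coe_smul, Pi.smul_apply, Pi.smul_apply, single_apply]
  rcases m' with _ | m'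
  · rw [Sl2Coord.sE_apply_zero]; simp
  · rw [Sl2Coord.sE_apply_succ, single_apply]
    by_cases h : l' = l ∧ m' = m
    · obtain ⟨rfl, rfl⟩ := h; simp [hl, hm.le, show m' + 1 ≤ d by omega]
    · have h' := not_and_or.1 h
      rw [if_neg, if_neg, smul_zero, smul_zero] <;> (rintro ⟨h1, h2, -, -⟩; rcases h' with h' | h' <;> omega)

/-- `R(E) δ_{l,d} = 0`. [folklore] -/
theorem coeff_RE_single_top (l : ℕ) : (GL2CESH.coeff (C := ℂ) d).RE (single d l d) = 0 := by
  apply Subtype.ext; funext l' m'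
  rw [GL2CESH.coeff, restrict_RE, GL2CESH.opsCoeff_RE]
  rcases m' with _ | m'
  · rw [Sl2Coord.sE_apply_zero]; rfl
  · rw [Sl2Coord.sE_apply_succ, single_apply]
    by_cases h : m' = d
    · subst h; simp
    · rw [if_neg (by tauto)]; simp

/-- `R(F) δ_{l,m+1} = (m+1) δ_{l,m}`. [folklore] -/
theorem coeff_RF_single_succ {l m : ℕ} (hl : l ≤ d) (hm : m + 1 ≤ d) :
    (GL2CESH.coeff (C := ℂ) d).RF (single d l (m + 1)) = ((m + 1 : ℕ) : ℂ) • single d l m := by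
  apply Subtype.ext; funext l' m'
  rw [GL2CESH.coeff, restrict_RF, GL2CESH.opsCoeff_RF, Sl2Coord.sF_apply, Submodule.coe_smul, Pi.smul_apply,
    Pi.smul_apply, single_apply, single_apply]
  by_cases h : l' = l ∧ m' = m
  · obtain ⟨rfl, rfl⟩ := h; simp [hl, hm, show m' ≤ d by omega]
  · have h' := not_and_or.1 h
    rw [if_neg, if_neg, smul_zero, smul_zero] <;> (rintro ⟨h1, h2, -, -⟩; rcases h' with h' | h' <;> omega)

/-- `R(F) δ_{l,0} = 0`. [folklore] -/
theorem coeff_RF_single_zero (l : ℕ) : (GL2CESH.coeff (C := ℂ) d).RF (single d l 0) = 0 := by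
  apply Subtype.ext; funext l' m'
  rw [GL2CESH.coeff, restrict_RF, GL2CESH.opsCoeff_RF, Sl2Coord.sF_apply, single_apply]
  simp

/-- `R(H) δ_{l,m} = (2m − d) δ_{l,m}`. [folklore] -/
theorem coeff_RH_single (l m : ℕ) :
    (GL2CESH.coeff (C := ℂ) d).RH (single d l m) = (((2 * m : ℕ) : ℂ) - d) • single d l m := by
  apply Subtype.ext; funext l' m'
  rw [GL2CESH.coeff, restrict_RH, GL2CESH.opsCoeff_RH, Sl2Coord.sH_apply, Submodule.coe_smul, Pi.smul_apply,
    Pi.smul_apply, single_apply]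
  by_cases h : l' = l ∧ m' = m ∧ l ≤ d ∧ m ≤ d
  · obtain ⟨-, rfl, -, -⟩ := h; rfl
  · rw [if_neg h, smul_zero, smul_zero]

end Model

/-! ### The intertwiner `θ` -/

section Theta

variable (d : ℕ) (u₀ : E)

/-- The normalising coefficient `l! (d − m)!`. [folklore] -/
def thetaCoeff (l m : ℕ) : ℂ := ((Nat.factorial l * Nat.factorial (d - m) : ℕ) : ℂ)

/-- `l! (d−m)! ≠ 0`. [folklore] -/
theorem thetaCoeff_ne_zero (l m : ℕ) : thetaCoeff d l m ≠ 0 := by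
  rw [thetaCoeff, Nat.cast_ne_zero]
  exact Nat.mul_ne_zero (Nat.factorial_ne_zero l) (Nat.factorial_ne_zero _)

/-- `(l+1)! (d−m)! = (l+1) · l! (d−m)!`. [folklore] -/
theorem thetaCoeff_succ_left (l m : ℕ) : thetaCoeff d (l + 1) m = ((l + 1 : ℕ) : ℂ) * thetaCoeff d l m := by
  rw [thetaCoeff, thetaCoeff, Nat.factorial_succ]; push_cast; ring

/-- `l! (d−m)! = (d−m) · l! (d−(m+1))!` (`m < d`). [folklore] -/
theorem thetaCoeff_right {l m : ℕ} (hm : m < d) : thetaCoeff d l m = ((d - m : ℕ) : ℂ) * thetaCoeff d l (m + 1) := by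
  rw [thetaCoeff, thetaCoeff, show d - m = (d - (m + 1)) + 1 by omega, Nat.factorial_succ]; push_cast; ring

/-- **The intertwiner** `θ(u) = ∑_{l,m ≤ d} u_{l,m} · l! (d−m)! · L(F)^{d−l} R(E)^m u₀`.
[cite: FultonHarrisGTM129, §11.1] -/
def theta : GL2CESH.model ℂ d →ₗ[ℂ] E where
  toFun u := ∑ l ∈ range (d + 1), ∑ m ∈ range (d + 1), ((u : ℕ → ℕ → ℂ) l m * thetaCoeff d l m) • O.bVec d u₀ l m
  map_add' u v := by
    simp only [Submodule.coe_add, Pi.add_apply, add_mul, add_smul, Finset.sum_add_distrib]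
  map_smul' c u := by
    simp only [Submodule.coe_smul, Pi.smul_apply, smul_eq_mul, mul_assoc, mul_smul, ← Finset.smul_sum,
      RingHom.id_apply]

/-- Unfolding. [folklore] -/
theorem theta_apply (u : GL2CESH.model ℂ d) :
    O.theta d u₀ u = ∑ l ∈ range (d + 1), ∑ m ∈ range (d + 1), ((u : ℕ → ℕ → ℂ) l m * thetaCoeff d l m) • O.bVec d u₀ l m :=
  rfl

/-- **`θ(δ_{l,m}) = l! (d−m)! · b_{l,m}`.** [cite: FultonHarrisGTM129, §11.1] -/
theorem theta_single {l m : ℕ} (hl : l ≤ d) (hm : m ≤ d) :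
    O.theta d u₀ (single d l m) = thetaCoeff d l m • O.bVec d u₀ l m := by
  rw [theta_apply, Finset.sum_eq_single l, Finset.sum_eq_single m]
  · rw [single_apply, if_pos ⟨rfl, rfl, hl, hm⟩, one_mul]
  · intro m' _ hne; rw [single_apply, if_neg (by rintro ⟨-, h, -⟩; exact hne h), zero_mul, zero_smul]
  · intro h; exact absurd (Finset.mem_range.2 (by omega)) h
  · intro l' _ hne
    exact Finset.sum_eq_zero fun m' _ => by
      rw [single_apply, if_neg (by rintro ⟨h, -⟩; exact hne h), zero_mul, zero_smul]
  · intro h; exact absurd (Finset.mem_range.2 (by omega)) h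

variable {d u₀} (hO : O.IsLawful) (hLE : O.LE u₀ = 0) (hLH : O.LH u₀ = (d : ℂ) • u₀) (hRF : O.RF u₀ = 0)
  (hRH : O.RH u₀ = -((d : ℂ) • u₀))
include hO

include hLE hLH in
/-- **`θ ∘ L(F)_{coord} = L(F) ∘ θ`.** [cite: FultonHarrisGTM129, §11.1] -/
theorem theta_LF [FiniteDimensional ℂ E] (u : GL2CESH.model ℂ d) :
    O.theta d u₀ ((GL2CESH.coeff (C := ℂ) d).LF u) = O.LF (O.theta d u₀ u) := by
  have := model_hom_ext d (f := O.theta d u₀ ∘ₗ (GL2CESH.coeff (C := ℂ) d).LF) (g := O.LF ∘ₗ O.theta d u₀) ?_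
  · exact LinearMap.congr_fun this u
  intro l m hl hm
  simp only [LinearMap.comp_apply]
  rcases l with _ | l
  · rw [coeff_LF_single_zero, map_zero, theta_single d u₀ (Nat.zero_le _) hm, map_smul, LF_bVec_zero hO hLE hLH,
      smul_zero]
  · rw [coeff_LF_single_succ d hl hm, map_smul, theta_single d u₀ (by omega) hm, theta_single d u₀ hl hm, map_smul,
      LF_bVec_succ hl, smul_smul, thetaCoeff_succ_left]

include hLE hLH in
/-- **`θ ∘ L(E)_{coord} = L(E) ∘ θ`.** [cite: FultonHarrisGTM129, §11.1] -/
theorem theta_LE (u : GL2CESH.model ℂ d) :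
    O.theta d u₀ ((GL2CESH.coeff (C := ℂ) d).LE u) = O.LE (O.theta d u₀ u) := by
  have := model_hom_ext d (f := O.theta d u₀ ∘ₗ (GL2CESH.coeff (C := ℂ) d).LE) (g := O.LE ∘ₗ O.theta d u₀) ?_
  · exact LinearMap.congr_fun this u
  intro l m hl hm
  simp only [LinearMap.comp_apply]
  rcases hl.lt_or_eq with hl | hl'
  · rw [coeff_LE_single d hl hm, map_smul, theta_single d u₀ hl hm, theta_single d u₀ hl.le hm, map_smul,
      LE_bVec hO hLE hLH hl, smul_smul, smul_smul, thetaCoeff_succ_left]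
    congr 1; push_cast; ring
  · rw [hl', coeff_LE_single_top, map_zero, theta_single d u₀ le_rfl hm, map_smul, LE_bVec_top hO hLE, smul_zero]

include hLE hLH in
/-- **`θ ∘ L(H)_{coord} = L(H) ∘ θ`.** [cite: FultonHarrisGTM129, §11.1] -/
theorem theta_LH (u : GL2CESH.model ℂ d) :
    O.theta d u₀ ((GL2CESH.coeff (C := ℂ) d).LH u) = O.LH (O.theta d u₀ u) := by
  have := model_hom_ext d (f := O.theta d u₀ ∘ₗ (GL2CESH.coeff (C := ℂ) d).LH) (g := O.LH ∘ₗ O.theta d u₀) ?_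
  · exact LinearMap.congr_fun this u
  intro l m hl hm
  simp only [LinearMap.comp_apply]
  rw [coeff_LH_single, map_smul, theta_single d u₀ hl hm, map_smul, LH_bVec hO hLE hLH hl, smul_smul, smul_smul,
    mul_comm]

include hRF hRH in
/-- **`θ ∘ R(E)_{coord} = R(E) ∘ θ`.** [cite: FultonHarrisGTM129, §11.1] -/
theorem theta_RE [FiniteDimensional ℂ E] (u : GL2CESH.model ℂ d) :
    O.theta d u₀ ((GL2CESH.coeff (C := ℂ) d).RE u) = O.RE (O.theta d u₀ u) := by
  have := model_hom_ext d (f := O.theta d u₀ ∘ₗ (GL2CESH.coeff (C := ℂ) d).RE) (g := O.RE ∘ₗ O.theta d u₀) ?_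
  · exact LinearMap.congr_fun this u
  intro l m hl hm
  simp only [LinearMap.comp_apply]
  rcases hm.lt_or_eq with hm | hm'
  · rw [coeff_RE_single d hl hm, map_smul, theta_single d u₀ hl hm, theta_single d u₀ hl hm.le, map_smul,
      RE_bVec hO, smul_smul, thetaCoeff_right d hm]
  · rw [hm', coeff_RE_single_top, map_zero, theta_single d u₀ hl le_rfl, map_smul, RE_bVec hO, bVec_top_succ hO hRF hRH,
      smul_zero]

include hRF hRH in
/-- **`θ ∘ R(F)_{coord} = R(F) ∘ θ`.** [cite: FultonHarrisGTM129, §11.1] -/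
theorem theta_RF (u : GL2CESH.model ℂ d) :
    O.theta d u₀ ((GL2CESH.coeff (C := ℂ) d).RF u) = O.RF (O.theta d u₀ u) := by
  have := model_hom_ext d (f := O.theta d u₀ ∘ₗ (GL2CESH.coeff (C := ℂ) d).RF) (g := O.RF ∘ₗ O.theta d u₀) ?_
  · exact LinearMap.congr_fun this u
  intro l m hl hm
  simp only [LinearMap.comp_apply]
  rcases m with _ | m
  · rw [coeff_RF_single_zero, map_zero, theta_single d u₀ hl (Nat.zero_le _), map_smul, RF_bVec_zero hO hRF, smul_zero]
  · rw [coeff_RF_single_succ d hl hm, map_smul, theta_single d u₀ hl (by omega), theta_single d u₀ hl hm, map_smul,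
      RF_bVec_succ hO hRF hRH, smul_smul, smul_smul, thetaCoeff_right d (show m < d by omega)]
    congr 1; push_cast [Nat.cast_sub (show m ≤ d by omega)]; ring

include hRF hRH in
/-- **`θ ∘ R(H)_{coord} = R(H) ∘ θ`.** [cite: FultonHarrisGTM129, §11.1] -/
theorem theta_RH (u : GL2CESH.model ℂ d) :
    O.theta d u₀ ((GL2CESH.coeff (C := ℂ) d).RH u) = O.RH (O.theta d u₀ u) := by
  have := model_hom_ext d (f := O.theta d u₀ ∘ₗ (GL2CESH.coeff (C := ℂ) d).RH) (g := O.RH ∘ₗ O.theta d u₀) ?_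
  · exact LinearMap.congr_fun this u
  intro l m hl hm
  simp only [LinearMap.comp_apply]
  rw [coeff_RH_single, map_smul, theta_single d u₀ hl hm, map_smul, RH_bVec hO hRF hRH, smul_smul, smul_smul, mul_comm]

/-! ### Injectivity and bijectivity -/

include hLE hLH hRF hRH in
/-- The `b_{l,m}` (`l, m ≤ d`) are joint weight vectors with distinct weights, hence linearly
independent. [cite: FultonHarrisGTM129, §11.1] -/
theorem linearIndependent_bVec [FiniteDimensional ℂ E] (hu : u₀ ≠ 0) :
    LinearIndependent ℂ (fun p : Fin (d + 1) × Fin (d + 1) => O.bVec d u₀ p.1 p.2) := by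
  -- the operator `P = L(H) + (d+1) R(H)` separates them
  let P : Module.End ℂ E := O.LH + ((d : ℂ) + 1) • O.RH
  let μ : Fin (d + 1) × Fin (d + 1) → ℂ := fun p =>
    ((((2 * (p.1 : ℕ) : ℕ) : ℂ) - d) + ((d : ℂ) + 1) * ((((2 * (p.2 : ℕ) : ℕ) : ℂ) - d)))
  have hμ : Function.Injective μ := by
    rintro ⟨a, b⟩ ⟨a', b'⟩ h
    simp only [μ] at h
    have h' : (2 * (a : ℕ) : ℤ) + ((d : ℤ) + 1) * (2 * (b : ℕ)) = 2 * (a' : ℕ) + ((d : ℤ) + 1) * (2 * (b' : ℕ)) := by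
      have h1 : (((2 * (a : ℕ) : ℕ) : ℂ) - d) + ((d : ℂ) + 1) * ((((2 * (b : ℕ) : ℕ) : ℂ) - d)) =
          (((2 * (a : ℕ) : ℤ) + ((d : ℤ) + 1) * (2 * (b : ℕ)) : ℤ) : ℂ) - (d + (d + 1) * d) := by push_cast; ring
      have h2 : (((2 * (a' : ℕ) : ℕ) : ℂ) - d) + ((d : ℂ) + 1) * ((((2 * (b' : ℕ) : ℕ) : ℂ) - d)) =
          (((2 * (a' : ℕ) : ℤ) + ((d : ℤ) + 1) * (2 * (b' : ℕ)) : ℤ) : ℂ) - (d + (d + 1) * d) := by push_cast; ring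
      rw [h1, h2] at h
      exact_mod_cast sub_left_injective h
    have ha := a.2; have hb := b.2; have ha' := a'.2; have hb' := b'.2
    have hbb : (b : ℕ) = b' := by
      by_contra hne
      rcases Nat.lt_or_gt_of_ne hne with hlt | hlt <;> nlinarith
    have hb2 : b = b' := Fin.ext hbb
    subst hb2
    have haa : (a : ℕ) = a' := by omega
    exact Prod.ext (Fin.ext haa) (Fin.ext hbb)
  refine Module.End.eigenvectors_linearIndependent' P μ hμ _ fun p => ?_
  refine ⟨Module.End.mem_eigenspace_iff.2 ?_, O.bVec_ne_zero hO hLE hLH hRF hRH hu p.1 (Nat.lt_succ_iff.1 p.2.2)⟩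
  simp only [P, μ, LinearMap.add_apply, LinearMap.smul_apply]
  rw [LH_bVec hO hLE hLH (Nat.lt_succ_iff.1 p.1.2), RH_bVec hO hRF hRH, smul_smul, ← add_smul]

include hLE hLH hRF hRH in
/-- **`θ` is injective.** [cite: FultonHarrisGTM129, §11.1] -/
theorem theta_injective [FiniteDimensional ℂ E] (hu : u₀ ≠ 0) : Function.Injective (O.theta d u₀) := by
  rw [← LinearMap.ker_eq_bot, Submodule.eq_bot_iff]
  intro u hu'
  rw [LinearMap.mem_ker, theta_apply] at hu'
  -- rewrite the double sum over `Fin (d+1) × Fin (d+1)`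
  have hsum : ∑ p : Fin (d + 1) × Fin (d + 1),
      ((u : ℕ → ℕ → ℂ) p.1 p.2 * thetaCoeff d p.1 p.2) • O.bVec d u₀ p.1 p.2 = 0 := by
    rw [Fintype.sum_prod_type, ← hu']
    rw [Finset.sum_range (fun l => ∑ m ∈ range (d + 1), ((u : ℕ → ℕ → ℂ) l m * thetaCoeff d l m) • O.bVec d u₀ l m)]
    refine Finset.sum_congr rfl fun i _ => ?_
    rw [Finset.sum_range (fun m => ((u : ℕ → ℕ → ℂ) i m * thetaCoeff d i m) • O.bVec d u₀ i m)]
  have hli := linearIndependent_bVec hO hLE hLH hRF hRH hu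
  have hcoef := (Fintype.linearIndependent_iff.1 hli) _ hsum
  apply Subtype.ext
  funext l m
  change (u : ℕ → ℕ → ℂ) l m = 0
  by_cases h : l ≤ d ∧ m ≤ d
  · have := hcoef (⟨l, Nat.lt_succ_iff.2 h.1⟩, ⟨m, Nat.lt_succ_iff.2 h.2⟩)
    simpa [thetaCoeff_ne_zero] using this
  · exact u.2 l m (by omega)

include hLE hLH hRF hRH in
/-- **`θ` is surjective when `dim E = (d+1)²`.** [cite: FultonHarrisGTM129, §11.1] -/
theorem theta_surjective [FiniteDimensional ℂ E] (hu : u₀ ≠ 0) (hdim : Module.finrank ℂ E = (d + 1) ^ 2) :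
    Function.Surjective (O.theta d u₀) := by
  have hli := linearIndependent_bVec hO hLE hLH hRF hRH hu
  have hspan := hli.span_eq_top_of_card_eq_finrank (by rw [hdim, Fintype.card_prod, Fintype.card_fin]; ring)
  rw [← LinearMap.range_eq_top, eq_top_iff, ← hspan, Submodule.span_le]
  rintro _ ⟨p, rfl⟩
  refine ⟨(thetaCoeff d p.1 p.2)⁻¹ • single d p.1 p.2, ?_⟩
  rw [map_smul, theta_single d u₀ (Nat.lt_succ_iff.1 p.1.2) (Nat.lt_succ_iff.1 p.2.2), smul_smul,
    inv_mul_cancel₀ (thetaCoeff_ne_zero d _ _), one_smul]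

include hLE hLH hRF hRH in
/-- **The intertwining isomorphism `θ : Sym^d ⊗ \overline{Sym}^d ≃ E`** (`dim E = (d+1)²`).
[cite: FultonHarrisGTM129, §11.1] -/
theorem theta_bijective [FiniteDimensional ℂ E] (hu : u₀ ≠ 0) (hdim : Module.finrank ℂ E = (d + 1) ^ 2) :
    Function.Bijective (O.theta d u₀) :=
  ⟨theta_injective hO hLE hLH hRF hRH hu, theta_surjective hO hLE hLH hRF hRH hu hdim⟩

end Theta

/-! ### Summary -/

/-- **Structure theorem.**  A finite-dimensional space `E` of dimension `(d+1)²` with six lawful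
operators and `Ω_L = Ω_R = ½ d(d+2)` is isomorphic to the coordinate model `Sym^d ⊗ \overline{Sym}^d`
(`GL2CESH.model ℂ d` with `GL2CESH.coeff d`) by a linear isomorphism intertwining all six operators.
[cite: FultonHarrisGTM129, §11.1] [cite: Knapp2002, §V.4] -/
theorem exists_modelEquiv [FiniteDimensional ℂ E] [Nontrivial E] (hO : O.IsLawful) {d : ℕ}
    (hcL : ∀ v, O.casL v = ((2 : ℂ)⁻¹ * ((d : ℂ) * ((d : ℂ) + 2))) • v)
    (hcR : ∀ v, O.casR v = ((2 : ℂ)⁻¹ * ((d : ℂ) * ((d : ℂ) + 2))) • v)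
    (hdim : Module.finrank ℂ E = (d + 1) ^ 2) :
    ∃ Θ : GL2CESH.model ℂ d ≃ₗ[ℂ] E,
      (∀ u, Θ ((GL2CESH.coeff (C := ℂ) d).LE u) = O.LE (Θ u)) ∧
      (∀ u, Θ ((GL2CESH.coeff (C := ℂ) d).LF u) = O.LF (Θ u)) ∧
      (∀ u, Θ ((GL2CESH.coeff (C := ℂ) d).LH u) = O.LH (Θ u)) ∧
      (∀ u, Θ ((GL2CESH.coeff (C := ℂ) d).RE u) = O.RE (Θ u)) ∧
      (∀ u, Θ ((GL2CESH.coeff (C := ℂ) d).RF u) = O.RF (Θ u)) ∧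
      (∀ u, Θ ((GL2CESH.coeff (C := ℂ) d).RH u) = O.RH (Θ u)) := by
  obtain ⟨v, hv⟩ := exists_ne (0 : E)
  obtain ⟨u₀, hu, hLE, hLH, hRF, hRH⟩ := exists_biExtremal hO hcL hcR hv
  refine ⟨LinearEquiv.ofBijective (O.theta d u₀) (theta_bijective hO hLE hLH hRF hRH hu hdim), ?_, ?_, ?_, ?_, ?_, ?_⟩
    <;> intro u <;> simp only [LinearEquiv.ofBijective_apply]
  · exact theta_LE hO hLE hLH u
  · exact theta_LF hO hLE hLH u
  · exact theta_LH hO hLE hLH u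
  · exact theta_RE hO hRF hRH u
  · exact theta_RF hO hRF hRH u
  · exact theta_RH hO hRF hRH u

end Ops

end GL2CKType

end Literature.NumberTheory.Automorphic

end
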